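import Mathlib
import Literature.Analysis.FluidPDE.LandauSolutions
import Literature.Analysis.FluidPDE.RadialCalculus
import Summits.NavierStokesRegularity.NavierStokesRegularity.Theorems.LandauTailLandauTailBlowupAngularReduction

/-!
# The momentum flux of the explicit Landau solution through the unit shell

Helper file of the stub `landauTail_landau_flux_eq` (S8) of the crux `LandauTail.LandauTailBlowup`
(stmt-NavierStokesRegularity-1944, line registered). For the Landau solution
`U = landauAxisField a A`, `P = landauAxisPressure a A` (unit axis `a`, parameter `A > 1`) and the
radial cutoff `Ψ₁(y) = smoothTransition (‖y‖² - 1)`,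

  `⟪a, ∫ (⟪U, ∇Ψ₁⟫ U + P ∇Ψ₁ + (ΔΨ₁) U)⟫ = 2π ∫_{-1}^{1} F_A(c) dc`,

`F_A = U_a (u_r + 1) + c p` with the angular profiles `u_r(c) = 2((A² - 1)/(A - c)² - 1)`,
`U_a(c) = c u_r(c) + 2(1 - c²)/(A - c)`, `p(c) = 4(Ac - 1)/(A - c)²` (Landau 1944; Batchelor §4.6;
Lemarié-Rieusset 2016, (10.48)). Proof: with `G(ρ) = smoothTransition (ρ - 1)`,
`∇Ψ₁(z) = 2G'(‖z‖²) z`, `ΔΨ₁(z) = 4‖z‖²G''(‖z‖²) + 6G'(‖z‖²)`; by `(-1)`/`(-2)`-homogeneity the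
integrand paired with `a` is `h₁(‖z‖) g₁(c) + h₂(‖z‖) g₂(c)` (`c = ⟪a, z⟫/‖z‖`); Archimedes' angular
reduction (`landauTail_integral_radial_mul_angular`) and the two radial moments
`∫₀^∞ 2sG'(s²) ds = ∫₀^∞ (4s³G''(s²) + 6sG'(s²)) ds = 1` give the claim.
-/

set_option linter.dupNamespace false

namespace Summit.NavierStokesRegularity.NavierStokesRegularity.Theorems

open MeasureTheory Metric Set Filter Topology InnerProductSpace Literature.Analysis.FluidPDE
open scoped RealInnerProductSpace Laplacian ContDiff

/-! ### The cutoff profile -/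

/-- `G(ρ) = smoothTransition (ρ - 1)` is smooth: its first two derivatives exist everywhere and are
continuous. [folklore] -/
theorem landauTail_cutoffProfile_smooth {G : ℝ → ℝ}
    (hG : G = fun ρ : ℝ => Real.smoothTransition (ρ - 1)) :
    (∀ x, HasDerivAt G (deriv G x) x) ∧ (∀ x, HasDerivAt (deriv G) (deriv (deriv G) x) x) ∧
      Continuous (deriv G) ∧ Continuous (deriv (deriv G)) := by
  have h0 : ContDiff ℝ ∞ G :=
    hG ▸ Real.smoothTransition.contDiff.comp (contDiff_id.sub contDiff_const)
  have h1 := contDiff_infty_iff_deriv.1 h0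
  have h2 := contDiff_infty_iff_deriv.1 h1.2
  exact ⟨fun x => (h1.1 x).hasDerivAt, fun x => (h2.1 x).hasDerivAt, h1.2.continuous,
    h2.2.continuous⟩

/-- `G(ρ) = smoothTransition (ρ - 1)` is locally constant off `[1, 2]`, so `G'` and `G''` vanish
there. [folklore] -/
theorem landauTail_cutoffProfile_deriv_eq_zero {G : ℝ → ℝ}
    (hG : G = fun ρ : ℝ => Real.smoothTransition (ρ - 1)) {ρ : ℝ} (hρ : ρ < 1 ∨ 2 < ρ) :
    deriv G ρ = 0 ∧ deriv (deriv G) ρ = 0 := by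
  subst hG
  have key : ∀ x : ℝ, (x < 1 ∨ 2 < x) →
      deriv (fun ρ : ℝ => Real.smoothTransition (ρ - 1)) x = 0 := by
    intro x hx
    rcases hx with hx | hx
    · have h : (fun ρ : ℝ => Real.smoothTransition (ρ - 1)) =ᶠ[𝓝 x] fun _ => (0 : ℝ) :=
        eventuallyEq_of_mem (Iio_mem_nhds hx) fun y hy =>
          Real.smoothTransition.zero_of_nonpos (by simp only [mem_Iio] at hy; linarith)
      rw [h.deriv_eq, deriv_const]
    · have h : (fun ρ : ℝ => Real.smoothTransition (ρ - 1)) =ᶠ[𝓝 x] fun _ => (1 : ℝ) :=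
        eventuallyEq_of_mem (Ioi_mem_nhds hx) fun y hy =>
          Real.smoothTransition.one_of_one_le (by simp only [mem_Ioi] at hy; linarith)
      rw [h.deriv_eq, deriv_const]
  refine ⟨key ρ hρ, ?_⟩
  have h : deriv (fun ρ : ℝ => Real.smoothTransition (ρ - 1)) =ᶠ[𝓝 ρ] fun _ => (0 : ℝ) :=
    eventuallyEq_of_mem ((isOpen_Iio.union isOpen_Ioi).mem_nhds (show ρ ∈ Iio 1 ∪ Ioi 2 from hρ))
      fun y hy => key y hy
  rw [h.deriv_eq, deriv_const]

/-- A continuous function vanishing near `0` stays continuous after division by the variable.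
[folklore] -/
theorem landauTail_continuous_div_self {f : ℝ → ℝ} (hf : Continuous f)
    (h0 : ∀ s, |s| < 1 / 2 → f s = 0) : Continuous fun s => f s / s := by
  refine continuous_iff_continuousAt.2 fun s => ?_
  rcases eq_or_ne s 0 with rfl | hs
  · refine Filter.EventuallyEq.continuousAt (y := (0 : ℝ)) ?_
    filter_upwards [ball_mem_nhds (0 : ℝ) one_half_pos] with x hx
    rw [h0 x (by simpa [Real.norm_eq_abs] using mem_ball_zero_iff.1 hx), zero_div]
  · exact hf.continuousAt.div continuousAt_id hs

/-- The radial profiles `s ↦ κ(s²)/s` built from a continuous `κ` vanishing off `[1, 2]`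
(extended by `0` to `s ≤ 0`) are continuous and vanish for `s ≤ 1/2` and `s ≥ 2`. [folklore] -/
theorem landauTail_radialProfile {κ : ℝ → ℝ} (hκ : Continuous κ)
    (h0 : ∀ ρ, ρ < 1 ∨ 2 < ρ → κ ρ = 0) :
    Continuous (fun s : ℝ => κ (max s 0 ^ 2) / s) ∧
      ∀ s : ℝ, (s ≤ 1 / 2 ∨ 2 ≤ s) → κ (max s 0 ^ 2) / s = 0 := by
  have hm : ∀ s : ℝ, s ≤ 1 / 2 → κ (max s 0 ^ 2) = 0 := fun s hs => by
    refine h0 _ (Or.inl ?_)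
    have h1 : max s 0 ≤ 1 / 2 := max_le hs (by norm_num)
    have h2 : 0 ≤ max s 0 := le_max_right _ _
    nlinarith
  refine ⟨landauTail_continuous_div_self (hκ.comp ((continuous_id.max continuous_const).pow 2))
    fun s hs => hm s (abs_lt.1 hs).2.le, fun s hs => ?_⟩
  rcases hs with hs | hs
  · rw [hm s hs, zero_div]
  · rw [max_eq_left (by linarith : (0 : ℝ) ≤ s), h0 _ (Or.inr (by nlinarith)), zero_div]

/-- Reduction of a radial moment over `(0, ∞)` to `[0, 2]` when the profile vanishes past `ρ = 2`:
`∫₀^∞ (κ(s²)/s) s² ds = ∫₀² κ(s²) s ds`. [folklore] -/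
theorem landauTail_radialMoment_eq_intervalIntegral {κ : ℝ → ℝ} (h0 : ∀ ρ, 2 < ρ → κ ρ = 0) :
    ∫ s in Ioi (0 : ℝ), κ (max s 0 ^ 2) / s * s ^ 2 = ∫ s in (0 : ℝ)..2, κ (s ^ 2) * s := by
  have hvan : ∀ s ∈ Ioi (0 : ℝ) \ Ioc 0 2, κ (max s 0 ^ 2) / s * s ^ 2 = 0 := by
    rintro s ⟨hs0, hs2⟩
    have hs0' : 0 < s := hs0
    have h2 : 2 < s := lt_of_not_ge fun h => hs2 ⟨hs0', h⟩
    rw [max_eq_left hs0'.le, h0 _ (by nlinarith), zero_div, zero_mul]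
  rw [setIntegral_eq_of_subset_of_forall_sdiff_eq_zero measurableSet_Ioi Ioc_subset_Ioi_self hvan,
    intervalIntegral.integral_of_le zero_le_two]
  refine setIntegral_congr_fun measurableSet_Ioc fun s hs => ?_
  have hs0 : s ≠ 0 := hs.1.ne'
  rw [max_eq_left hs.1.le]
  field_simp

/-- First radial moment of the cutoff: `∫₀^∞ 2 s G'(s²) ds = G(4) - G(0) = 1`. [folklore] -/
theorem landauTail_radialMoment_one {G : ℝ → ℝ}
    (hG : G = fun ρ : ℝ => Real.smoothTransition (ρ - 1)) :
    ∫ s in Ioi (0 : ℝ), 2 * deriv G (max s 0 ^ 2) / s * s ^ 2 = 1 := by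
  obtain ⟨hd₁, -, hc₁, -⟩ := landauTail_cutoffProfile_smooth hG
  have h4 : G ((2 : ℝ) ^ 2) = 1 := hG ▸ Real.smoothTransition.one_of_one_le (by norm_num)
  have h0 : G ((0 : ℝ) ^ 2) = 0 := hG ▸ Real.smoothTransition.zero_of_nonpos (by norm_num)
  calc ∫ s in Ioi (0 : ℝ), 2 * deriv G (max s 0 ^ 2) / s * s ^ 2
      = ∫ s in (0 : ℝ)..2, 2 * deriv G (s ^ 2) * s :=
        landauTail_radialMoment_eq_intervalIntegral (κ := fun ρ => 2 * deriv G ρ) fun ρ hρ => by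
          simp only [(landauTail_cutoffProfile_deriv_eq_zero hG (Or.inr hρ)).1, mul_zero]
    _ = G ((2 : ℝ) ^ 2) - G ((0 : ℝ) ^ 2) := by
        refine intervalIntegral.integral_eq_sub_of_hasDerivAt (f := fun s => G (s ^ 2))
          (fun s _ => ?_) ((by fun_prop : Continuous fun s =>
            2 * deriv G (s ^ 2) * s).intervalIntegrable _ _)
        have hsq : HasDerivAt (fun x : ℝ => x ^ 2) (2 * s) s := by simpa using hasDerivAt_pow 2 s
        refine ((hd₁ (s ^ 2)).comp s hsq).congr_deriv ?_
        ring
    _ = 1 := by rw [h4, h0, sub_zero]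

/-- Second radial moment of the cutoff:
`∫₀^∞ (4 s³ G''(s²) + 6 s G'(s²)) ds = [2 s² G'(s²) + G(s²)]₀² = 1`. [folklore] -/
theorem landauTail_radialMoment_two {G : ℝ → ℝ}
    (hG : G = fun ρ : ℝ => Real.smoothTransition (ρ - 1)) :
    ∫ s in Ioi (0 : ℝ), (4 * deriv (deriv G) (max s 0 ^ 2) * max s 0 ^ 2 +
      6 * deriv G (max s 0 ^ 2)) / s * s ^ 2 = 1 := by
  obtain ⟨hd₁, hd₂, hc₁, hc₂⟩ := landauTail_cutoffProfile_smooth hG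
  have h4 : G ((2 : ℝ) ^ 2) = 1 := hG ▸ Real.smoothTransition.one_of_one_le (by norm_num)
  have h0 : G ((0 : ℝ) ^ 2) = 0 := hG ▸ Real.smoothTransition.zero_of_nonpos (by norm_num)
  have h4' : deriv G ((2 : ℝ) ^ 2) = 0 :=
    (landauTail_cutoffProfile_deriv_eq_zero hG (Or.inr (by norm_num))).1
  calc ∫ s in Ioi (0 : ℝ), (4 * deriv (deriv G) (max s 0 ^ 2) * max s 0 ^ 2 +
        6 * deriv G (max s 0 ^ 2)) / s * s ^ 2
      = ∫ s in (0 : ℝ)..2, (4 * deriv (deriv G) (s ^ 2) * s ^ 2 + 6 * deriv G (s ^ 2)) * s :=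
        landauTail_radialMoment_eq_intervalIntegral
          (κ := fun ρ => 4 * deriv (deriv G) ρ * ρ + 6 * deriv G ρ) fun ρ hρ => by
          obtain ⟨h₁, h₂⟩ := landauTail_cutoffProfile_deriv_eq_zero hG (Or.inr hρ)
          simp only [h₁, h₂, mul_zero, zero_mul, add_zero]
    _ = (2 * (2 : ℝ) ^ 2 * deriv G ((2 : ℝ) ^ 2) + G ((2 : ℝ) ^ 2)) -
          (2 * (0 : ℝ) ^ 2 * deriv G ((0 : ℝ) ^ 2) + G ((0 : ℝ) ^ 2)) := by
        refine intervalIntegral.integral_eq_sub_of_hasDerivAt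
          (f := fun s => 2 * s ^ 2 * deriv G (s ^ 2) + G (s ^ 2)) (fun s _ => ?_)
          ((by fun_prop : Continuous fun s => (4 * deriv (deriv G) (s ^ 2) * s ^ 2 +
            6 * deriv G (s ^ 2)) * s).intervalIntegrable _ _)
        have hsq : HasDerivAt (fun x : ℝ => x ^ 2) (2 * s) s := by simpa using hasDerivAt_pow 2 s
        refine (((hsq.const_mul 2).mul ((hd₂ (s ^ 2)).comp s hsq)).add
          ((hd₁ (s ^ 2)).comp s hsq)).congr_deriv ?_
        simp only [Function.comp_apply]
        ring
    _ = 1 := by rw [h4, h0, h4']; norm_num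

/-! ### The Landau solution in the spherical variables `r = ‖z‖`, `c = ⟪a, z⟫/‖z‖` -/

/-- The Landau solution in spherical variables about the axis `a` (`r = ‖z‖`, `c = ⟪a, z⟫ / r`):
`⟪U z, z⟫ = u_r(c) = 2((A² - 1)/(A - c)² - 1)` (degree `0`),
`⟪U z, a⟫ = U_a(c)/r`, `U_a(c) = c u_r(c) + 2(1 - c²)/(A - c)`, and `P z = p(c)/r²`,
`p(c) = 4(Ac - 1)/(A - c)²` (Landau 1944; Šverák 2011, (4.7)). [folklore] -/
theorem landauTail_landau_spherical {a z : EuclideanSpace ℝ (Fin 3)} (ha : ‖a‖ = 1) {A : ℝ}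
    (hA : 1 < A) (hz : z ≠ 0) :
    ⟪landauAxisField a A z, z⟫ = 2 * ((A ^ 2 - 1) / (A - ⟪a, z⟫ / ‖z‖) ^ 2 - 1) ∧
    ⟪landauAxisField a A z, a⟫ =
      (⟪a, z⟫ / ‖z‖ * (2 * ((A ^ 2 - 1) / (A - ⟪a, z⟫ / ‖z‖) ^ 2 - 1)) +
        2 * (1 - (⟪a, z⟫ / ‖z‖) ^ 2) / (A - ⟪a, z⟫ / ‖z‖)) / ‖z‖ ∧
    landauAxisPressure a A z = 4 * (A * (⟪a, z⟫ / ‖z‖) - 1) / (A - ⟪a, z⟫ / ‖z‖) ^ 2 / ‖z‖ ^ 2 := by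
  have hr : ‖z‖ ≠ 0 := norm_ne_zero_iff.2 hz
  have hd : A * ‖z‖ - ⟪a, z⟫ ≠ 0 := landauAxis_denom_ne_zero ha (hA.trans_le (le_abs_self A)) hz
  have hd' : A - ⟪a, z⟫ / ‖z‖ ≠ 0 := by
    rw [Ne, sub_eq_zero]
    intro h
    apply hd
    rw [h, div_mul_cancel₀ _ hr, sub_self]
  have haa : ⟪a, a⟫ = 1 := by rw [real_inner_self_eq_norm_sq, ha, one_pow]
  refine ⟨?_, ?_, ?_⟩
  · simp only [landauAxisField, inner_add_left, inner_sub_left, real_inner_smul_left,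
      real_inner_self_eq_norm_sq]
    field_simp
    ring
  · simp only [landauAxisField, inner_add_left, inner_sub_left, real_inner_smul_left, haa,
      real_inner_comm z a]
    field_simp
  · simp only [landauAxisPressure]
    field_simp

/-- The convective and pressure parts of the flux integrand paired with the axis: for `z ≠ 0` and
any scalar `t` (the value `2G'(‖z‖²)` of the gradient factor, `∇Ψ₁ z = t z`),
`⟪a, ⟪U z, t z⟫ U z + P z (t z)⟫ = (t/r) (u_r U_a + c p)(c)`. [folklore] -/
theorem landauTail_landau_flux_pointwise_grad {a z : EuclideanSpace ℝ (Fin 3)} (ha : ‖a‖ = 1)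
    {A : ℝ} (hA : 1 < A) (hz : z ≠ 0) (t : ℝ) :
    ⟪a, ⟪landauAxisField a A z, t • z⟫ • landauAxisField a A z +
        landauAxisPressure a A z • t • z⟫ =
      t / ‖z‖ * (2 * ((A ^ 2 - 1) / (A - ⟪a, z⟫ / ‖z‖) ^ 2 - 1) *
          (⟪a, z⟫ / ‖z‖ * (2 * ((A ^ 2 - 1) / (A - ⟪a, z⟫ / ‖z‖) ^ 2 - 1)) +
            2 * (1 - (⟪a, z⟫ / ‖z‖) ^ 2) / (A - ⟪a, z⟫ / ‖z‖)) +
        ⟪a, z⟫ / ‖z‖ * (4 * (A * (⟪a, z⟫ / ‖z‖) - 1) / (A - ⟪a, z⟫ / ‖z‖) ^ 2)) := by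
  obtain ⟨h1, h2, h3⟩ := landauTail_landau_spherical ha hA hz
  rw [inner_add_right, real_inner_smul_right, real_inner_smul_right, real_inner_smul_right,
    real_inner_smul_right, real_inner_comm (landauAxisField a A z) a, h1, h2, h3]
  ring

/-- The cutoff-Laplacian part of the flux integrand paired with the axis: for `z ≠ 0` and any
scalar `t` (the value of `ΔΨ₁ z`), `⟪a, t U z⟫ = (t/r) U_a(c)`. [folklore] -/
theorem landauTail_landau_flux_pointwise_lap {a z : EuclideanSpace ℝ (Fin 3)} (ha : ‖a‖ = 1)
    {A : ℝ} (hA : 1 < A) (hz : z ≠ 0) (t : ℝ) :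
    ⟪a, t • landauAxisField a A z⟫ =
      t / ‖z‖ * (⟪a, z⟫ / ‖z‖ * (2 * ((A ^ 2 - 1) / (A - ⟪a, z⟫ / ‖z‖) ^ 2 - 1)) +
        2 * (1 - (⟪a, z⟫ / ‖z‖) ^ 2) / (A - ⟪a, z⟫ / ‖z‖)) := by
  rw [real_inner_smul_right, real_inner_comm (landauAxisField a A z) a,
    (landauTail_landau_spherical ha hA hz).2.1]
  ring

/-! ### Calculus of the radial cutoff and integrability on the shell -/

/-- Gradient of a radial function: if `g` has derivative `g₁` at `‖z‖²` then
`∇(g(‖·‖²))(z) = 2 g₁ z`. [folklore] -/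
theorem landauTail_hasGradientAt_comp_norm_sq {g : ℝ → ℝ} {g₁ : ℝ} {z : EuclideanSpace ℝ (Fin 3)}
    (hg : HasDerivAt g g₁ (‖z‖ ^ 2)) :
    HasGradientAt (fun w : EuclideanSpace ℝ (Fin 3) => g (‖w‖ ^ 2)) ((2 * g₁) • z) z := by
  have heq : toDual ℝ (EuclideanSpace ℝ (Fin 3)) ((2 * g₁) • z) =
      (2 * g₁) • (innerSL ℝ z : EuclideanSpace ℝ (Fin 3) →L[ℝ] ℝ) := by
    ext v
    simp
  rw [hasGradientAt_iff_hasFDerivAt, heq]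
  exact hasFDerivAt_comp_norm_sq hg

/-- Gradient and Laplacian of `G(‖·‖²)` on `ℝ³` for a twice differentiable profile `G`:
`∇ = 2G'(‖z‖²) z`, `Δ = 4G''(‖z‖²)‖z‖² + 6G'(‖z‖²)`. [folklore] -/
theorem landauTail_gradient_laplacian_radial {G : ℝ → ℝ} (hd₁ : ∀ x, HasDerivAt G (deriv G x) x)
    (hd₂ : ∀ x, HasDerivAt (deriv G) (deriv (deriv G) x) x) (z : EuclideanSpace ℝ (Fin 3)) :
    gradient (fun w : EuclideanSpace ℝ (Fin 3) => G (‖w‖ ^ 2)) z = (2 * deriv G (‖z‖ ^ 2)) • z ∧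
      (Δ fun w : EuclideanSpace ℝ (Fin 3) => G (‖w‖ ^ 2)) z =
        4 * deriv (deriv G) (‖z‖ ^ 2) * ‖z‖ ^ 2 + 6 * deriv G (‖z‖ ^ 2) := by
  refine ⟨(landauTail_hasGradientAt_comp_norm_sq (hd₁ _)).gradient, ?_⟩
  rw [laplacian_comp_norm_sq isOpen_univ (fun σ _ => hd₁ σ) (mem_univ _) (hd₂ _),
    finrank_euclideanSpace_fin]
  push_cast
  ring

/-- A field on `ℝ³` which is continuous off the origin and vanishes off the shell
`1 ≤ ‖z‖² ≤ 2` is (continuous and compactly supported, hence) integrable. [folklore] -/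
theorem landauTail_integrable_of_shell {F : Type*} [NormedAddCommGroup F] [NormedSpace ℝ F]
    {f : EuclideanSpace ℝ (Fin 3) → F} (hc : ∀ z, z ≠ 0 → ContinuousAt f z)
    (h0 : ∀ z, (‖z‖ ^ 2 < 1 ∨ 2 < ‖z‖ ^ 2) → f z = 0) : Integrable f := by
  have hcont : Continuous f := by
    refine continuous_iff_continuousAt.2 fun z => ?_
    rcases eq_or_ne z 0 with rfl | hz
    · refine Filter.EventuallyEq.continuousAt (y := (0 : F)) ?_
      filter_upwards [(isOpen_lt (continuous_norm.pow 2) continuous_const).mem_nhds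
        (show ‖(0 : EuclideanSpace ℝ (Fin 3))‖ ^ 2 < 1 by simp)] with y hy using h0 y (Or.inl hy)
    · exact hc z hz
  refine hcont.integrable_of_hasCompactSupport
    (HasCompactSupport.intro (isCompact_closedBall 0 2) fun z hz => h0 z (Or.inr ?_))
  rw [mem_closedBall, dist_zero_right, not_le] at hz
  nlinarith

/-- The angular profiles `g₁ = u_r U_a + c p` and `g₂ = U_a` are continuous on `[-1, 1]`
(`A - c ≥ A - 1 > 0` there). [folklore] -/
theorem landauTail_angular_continuousOn {A : ℝ} (hA : 1 < A) :
    ContinuousOn (fun c : ℝ => 2 * ((A ^ 2 - 1) / (A - c) ^ 2 - 1) *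
        (c * (2 * ((A ^ 2 - 1) / (A - c) ^ 2 - 1)) + 2 * (1 - c ^ 2) / (A - c)) +
      c * (4 * (A * c - 1) / (A - c) ^ 2)) (Icc (-1) 1) ∧
    ContinuousOn (fun c : ℝ => c * (2 * ((A ^ 2 - 1) / (A - c) ^ 2 - 1)) +
      2 * (1 - c ^ 2) / (A - c)) (Icc (-1) 1) := by
  have key : ∀ c ∈ Icc (-1 : ℝ) 1, A - c ≠ 0 ∧ (A - c) ^ 2 ≠ 0 := fun c hc => by
    have h : 0 < A - c := by linarith [hc.2]
    exact ⟨h.ne', pow_ne_zero 2 h.ne'⟩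
  refine ⟨fun c hc => ?_, fun c hc => ?_⟩ <;> obtain ⟨h1, h2⟩ := key c hc <;>
    refine ContinuousAt.continuousWithinAt ?_ <;> fun_prop (disch := assumption)

/-! ### The flux of the Landau solution -/

/-- **The momentum flux of the Landau solution through the unit shell.** For the Landau solution
`U = landauAxisField a A`, `P = landauAxisPressure a A` (`‖a‖ = 1`, `A > 1`) and the radial
cutoff `Ψ₁(y) = smoothTransition (‖y‖² - 1)`,
`⟪a, ∫ (⟪U, ∇Ψ₁⟫ U + P ∇Ψ₁ + (ΔΨ₁) U)⟫ = 2π ∫_{-1}^{1} F_A`, `F_A = U_a (u_r + 1) + c p`: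
the cutoff calculus `∇Ψ₁ = 2G'(‖z‖²) z`, `ΔΨ₁ = 4‖z‖²G'' + 6G'`, the spherical form of `(U, P)`,
Archimedes' angular reduction `landauTail_integral_radial_mul_angular`, and the radial moments
`∫₀^∞ 2sG'(s²) = ∫₀^∞ (4s³G'' + 6sG') = 1` (Landau 1944; Batchelor 1967, §4.6;
Lemarié-Rieusset 2016, (10.48)). [folklore] -/
theorem landauTail_landau_flux_eq : ∀ (a : EuclideanSpace ℝ (Fin 3)) (A : ℝ), ‖a‖ = 1 → 1 < A → inner ℝ a (∫ z, (inner ℝ (Literature.Analysis.FluidPDE.landauAxisField a A z) (gradient (fun y : EuclideanSpace ℝ (Fin 3) => Real.smoothTransition (‖y‖ ^ 2 - 1)) z) • Literature.Analysis.FluidPDE.landauAxisField a A z + Literature.Analysis.FluidPDE.landauAxisPressure a A z • gradient (fun y : EuclideanSpace ℝ (Fin 3) => Real.smoothTransition (‖y‖ ^ 2 - 1)) z + Laplacian.laplacian (fun y : EuclideanSpace ℝ (Fin 3) => Real.smoothTransition (‖y‖ ^ 2 - 1)) z • Literature.Analysis.FluidPDE.landauAxisField a A z)) = 2 * Real.pi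 * ∫ c in (-1 : ℝ)..1, ((c * (2 * ((A ^ 2 - 1) / (A - c) ^ 2 - 1)) + 2 * (1 - c ^ 2) / (A - c)) * (2 * ((A ^ 2 - 1) / (A - c) ^ 2 - 1) + 1) + c * (4 * (A * c - 1) / (A - c) ^ 2)) := by
  intro a A ha hA
  have hA' : 1 < |A| := hA.trans_le (le_abs_self A)
  set G : ℝ → ℝ := fun ρ : ℝ => Real.smoothTransition (ρ - 1) with hG
  obtain ⟨hd₁, hd₂, hc₁, hc₂⟩ := landauTail_cutoffProfile_smooth hG
  -- the cutoff calculus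
  have hgrad : ∀ z : EuclideanSpace ℝ (Fin 3),
      gradient (fun y => Real.smoothTransition (‖y‖ ^ 2 - 1)) z = (2 * deriv G (‖z‖ ^ 2)) • z :=
    fun z => (landauTail_gradient_laplacian_radial hd₁ hd₂ z).1
  have hlap : ∀ z : EuclideanSpace ℝ (Fin 3),
      (Δ fun y : EuclideanSpace ℝ (Fin 3) => Real.smoothTransition (‖y‖ ^ 2 - 1)) z =
        4 * deriv (deriv G) (‖z‖ ^ 2) * ‖z‖ ^ 2 + 6 * deriv G (‖z‖ ^ 2) := fun z =>
    (landauTail_gradient_laplacian_radial hd₁ hd₂ z).2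
  simp only [hgrad, hlap]
  -- the two vector integrands and the angular profiles
  set U := landauAxisField a A with hU
  set P := landauAxisPressure a A with hP
  set V₁ := fun z => ⟪U z, (2 * deriv G (‖z‖ ^ 2)) • z⟫ • U z +
    P z • (2 * deriv G (‖z‖ ^ 2)) • z with hV₁
  set V₂ := fun z =>
    (4 * deriv (deriv G) (‖z‖ ^ 2) * ‖z‖ ^ 2 + 6 * deriv G (‖z‖ ^ 2)) • U z with hV₂
  set g₁ : ℝ → ℝ := fun c => 2 * ((A ^ 2 - 1) / (A - c) ^ 2 - 1) *
      (c * (2 * ((A ^ 2 - 1) / (A - c) ^ 2 - 1)) + 2 * (1 - c ^ 2) / (A - c)) +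
    c * (4 * (A * c - 1) / (A - c) ^ 2) with hg₁
  set g₂ : ℝ → ℝ := fun c => c * (2 * ((A ^ 2 - 1) / (A - c) ^ 2 - 1)) +
    2 * (1 - c ^ 2) / (A - c) with hg₂
  obtain ⟨hg₁c, hg₂c⟩ : ContinuousOn g₁ (Icc (-1) 1) ∧ ContinuousOn g₂ (Icc (-1) 1) :=
    landauTail_angular_continuousOn hA
  -- continuity off the origin and vanishing off the shell
  have hUc : ∀ z, z ≠ 0 → ContinuousAt U z := fun z hz =>
    (contDiffOn_landauAxisField (n := 0) ha hA').continuousOn.continuousAt (isOpen_ne.mem_nhds hz)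
  have hPc : ∀ z, z ≠ 0 → ContinuousAt P z := fun z hz =>
    (contDiffOn_landauAxisPressure (n := 0) ha hA').continuousOn.continuousAt
      (isOpen_ne.mem_nhds hz)
  have hq : Continuous fun z : EuclideanSpace ℝ (Fin 3) => (2 * deriv G (‖z‖ ^ 2)) • z :=
    (continuous_const.mul (hc₁.comp (continuous_norm.pow 2))).smul continuous_id
  have hℓ : Continuous fun z : EuclideanSpace ℝ (Fin 3) =>
      4 * deriv (deriv G) (‖z‖ ^ 2) * ‖z‖ ^ 2 + 6 * deriv G (‖z‖ ^ 2) :=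
    ((continuous_const.mul (hc₂.comp (continuous_norm.pow 2))).mul (continuous_norm.pow 2)).add
      (continuous_const.mul (hc₁.comp (continuous_norm.pow 2)))
  have hV₁i : Integrable V₁ := by
    refine landauTail_integrable_of_shell
      (fun z hz => (((hUc z hz).inner hq.continuousAt).fun_smul (hUc z hz)).fun_add
        ((hPc z hz).fun_smul hq.continuousAt)) fun z hz => ?_
    simp only [hV₁, (landauTail_cutoffProfile_deriv_eq_zero hG hz).1, mul_zero, zero_smul,
      inner_zero_right, smul_zero, add_zero]
  have hV₂i : Integrable V₂ := by
    refine landauTail_integrable_of_shell (fun z hz => hℓ.continuousAt.fun_smul (hUc z hz))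
      fun z hz => ?_
    obtain ⟨h₁, h₂⟩ := landauTail_cutoffProfile_deriv_eq_zero hG hz
    simp only [hV₂, h₁, h₂, mul_zero, zero_mul, add_zero, zero_smul]
  -- the radial profiles
  obtain ⟨h₁c, h₁0⟩ : Continuous (fun s : ℝ => 2 * deriv G (max s 0 ^ 2) / s) ∧
      ∀ s : ℝ, (s ≤ 1 / 2 ∨ 2 ≤ s) → 2 * deriv G (max s 0 ^ 2) / s = 0 :=
    landauTail_radialProfile (κ := fun ρ => 2 * deriv G ρ) (continuous_const.mul hc₁)
      fun ρ hρ => by simp only [(landauTail_cutoffProfile_deriv_eq_zero hG hρ).1, mul_zero]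
  obtain ⟨h₂c, h₂0⟩ : Continuous (fun s : ℝ => (4 * deriv (deriv G) (max s 0 ^ 2) * max s 0 ^ 2 +
      6 * deriv G (max s 0 ^ 2)) / s) ∧ ∀ s : ℝ, (s ≤ 1 / 2 ∨ 2 ≤ s) →
        (4 * deriv (deriv G) (max s 0 ^ 2) * max s 0 ^ 2 + 6 * deriv G (max s 0 ^ 2)) / s = 0 :=
    landauTail_radialProfile (κ := fun ρ => 4 * deriv (deriv G) ρ * ρ + 6 * deriv G ρ)
      (((continuous_const.mul hc₂).mul continuous_id).add (continuous_const.mul hc₁))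
      fun ρ hρ => by
        obtain ⟨h₁, h₂⟩ := landauTail_cutoffProfile_deriv_eq_zero hG hρ
        simp only [h₁, h₂, mul_zero, zero_mul, add_zero]
  -- the two angular reductions
  have key₁ : ⟪a, ∫ z, V₁ z⟫ = 2 * Real.pi * ∫ c in (-1 : ℝ)..1, g₁ c := by
    have hpt : ∀ z, ⟪a, V₁ z⟫ =
        (fun s : ℝ => 2 * deriv G (max s 0 ^ 2) / s) ‖z‖ * g₁ (⟪a, z⟫ / ‖z‖) := by
      intro z
      rcases eq_or_ne z 0 with rfl | hz
      · simp [hV₁, hU]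
      · simp only [hV₁, hg₁, hU, hP, max_eq_left (norm_nonneg z)]
        exact landauTail_landau_flux_pointwise_grad ha hA hz _
    rw [← integral_inner hV₁i, integral_congr_ae (Eventually.of_forall hpt),
      landauTail_integral_radial_mul_angular a _ _ ha h₁c ⟨1 / 2, 2, one_half_pos, by norm_num, h₁0⟩
        hg₁c, landauTail_radialMoment_one hG, mul_one]
  have key₂ : ⟪a, ∫ z, V₂ z⟫ = 2 * Real.pi * ∫ c in (-1 : ℝ)..1, g₂ c := by
    have hpt : ∀ z, ⟪a, V₂ z⟫ =
        (fun s : ℝ => (4 * deriv (deriv G) (max s 0 ^ 2) * max s 0 ^ 2 +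
          6 * deriv G (max s 0 ^ 2)) / s) ‖z‖ * g₂ (⟪a, z⟫ / ‖z‖) := by
      intro z
      rcases eq_or_ne z 0 with rfl | hz
      · simp [hV₂, hU]
      · simp only [hV₂, hg₂, hU, max_eq_left (norm_nonneg z)]
        exact landauTail_landau_flux_pointwise_lap ha hA hz _
    rw [← integral_inner hV₂i, integral_congr_ae (Eventually.of_forall hpt),
      landauTail_integral_radial_mul_angular a _ _ ha h₂c ⟨1 / 2, 2, one_half_pos, by norm_num, h₂0⟩
        hg₂c, landauTail_radialMoment_two hG, mul_one]
  -- assembly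
  rw [integral_add hV₁i hV₂i, inner_add_right, key₁, key₂, ← mul_add,
    ← intervalIntegral.integral_add (hg₁c.intervalIntegrable_of_Icc (by norm_num))
      (hg₂c.intervalIntegrable_of_Icc (by norm_num))]
  congr 1
  refine intervalIntegral.integral_congr fun c _ => ?_
  simp only [hg₁, hg₂]
  ring

end Summit.NavierStokesRegularity.NavierStokesRegularity.Theorems
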